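import Literature.NumberTheory.DiophantineGeometry.GenEllPullbackConductor
import Literature.NumberTheory.DiophantineGeometry.GenEllDeBadPrimes
import HarnessLib

/-!
# [GenEll] Thm. 2.1 assembly, piece (J-B): a point meeting the pulled-back cusp divisor `ρ*C` at a
# good prime is adically close to a root of its equation

S. Mochizuki, *Arithmetic elliptic curves in general position*, Math. J. Okayama Univ. **52** (2010)
1–28, Def. 1.5 (iv) p. 8 (the conductor `(D_y)_red` of a point w.r.t. an effective divisor `D` of
`ℙ¹_ℤ`) as used in the proof of Thm. 2.1 pp. 12–13 [cite: MochizukiGenEll2010, Def 1.5 (iv) p.8].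
PROOF-ONLY support file (abc-iut cell, classical `GenEllTwo` chain, item `stmt-ABC-19679`; piece
«J-B» requested by the `GenEllMechanismAssembly` holder abc-iut-w5-d075, written by abc-iut-w5-d176):
no definitions, nothing of the disputed corpus.

For a finite map `ρ = (F : G) : ℙ¹ → ℙ¹` (`P1FiniteMap`, forms of degree `n`, dehomogenised
`f, g ∈ ℤ[t]`) whose three polynomials `f`, `g`, `f − g` have EXACT degree `n`, the pulled-back cusp
divisor `ρ*C = V(m)`, `m = f·g·(f − g)` (`P1FiniteMap.pullbackCusps`, `deg = 3n = deg m`), and a point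
`y = (x : 1)` over a number field `L` (`NFPoint`):

* `valuation_aeval_eq_pow_of_one_lt` — the ultrametric «dominant term»: if `p ∈ ℤ[t]` has `w`-unit
  leading coefficient and `|x|_w > 1` then `|p(x)|_w = |x|_w^{deg p}`;
* `NFPoint.exists_root_valuation_sub_lt_one_of_mem_condSupportDiv` — if `m` splits over `L`, `w` is a
  finite place of `L` at which the leading coefficient of `m` is a unit, and `y` MEETS `ρ*C` at `w`
  (`w ∈ condSupportDiv`, i.e. `|m(x)|_w < max(|x|_w, 1)^{3n}`), then `|x − b|_w < 1` for some root `b`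
  of `m` in `L` (the case `|x|_w > 1` is impossible by the dominant term; for `|x|_w ≤ 1`,
  `m(x) = lc · ∏_b (x − b)` has a factor of absolute value `< 1`);
* `P1FiniteMap.exists_primes_forall_mem_condSupportDiv` — the packaged form with the finite set
  `S` of rational primes dividing the leading coefficient of `m` («the bad primes of `ρ`»): off `S`,
  meeting `ρ*C` at `w` forces `|x − b|_w < 1` for a root `b`;
* `…_ord` variants — the same with the conclusion `0 < ord_w(x − b)` (`Literature.IUT.LogVolume.ord`),
  which needs `x` off `ρ*C` (`NFPoint.OffDiv`; for `x` ON the divisor the `ord`-form fails at `x = b`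
  because of the junk value `ord_w 0 = 0`, while the valuation form still holds).

The finite set `S` depends on `ρ` only (not on the point or its field), as the assembly requires.
-/

noncomputable section

namespace Literature.NumberTheory.DiophantineGeometry.GenEll

open _root_.Polynomial NumberField IsDedekindDomain
open Literature.IUT.LogVolume

/-! ### Valuation lemmas at a finite place of a number field -/

section Val

variable {L : Type} [Field L] [NumberField L] (w : HeightOneSpectrum (𝓞 L))

/-- Rational integers are `w`-integral: `|n|_w ≤ 1` (used to read Def. 1.5 (iv) at a finite place).
[cite: MochizukiGenEll2010, Def 1.5 (iv) p.8] -/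
theorem valuation_intCast_le_one (n : ℤ) : w.valuation L (n : L) ≤ 1 := by
  have h := valuation_le_one_of_isIntegral_int w
    (isIntegral_algebraMap (R := ℤ) (A := L) (x := n))
  simpa using h

open scoped Classical in
/-- **Off the primes dividing `c`, the integer `c ≠ 0` is a `w`-unit**: if the finite place `w` does
not lie over any prime factor of `|c|` then `|c|_w = 1` (the «bad primes of `ρ`» of the `GenEllTwo`
assembly are read this way). [cite: MochizukiGenEll2010, Def 1.5 (iv) p.8] -/
theorem valuation_intCast_eq_one_of_not_mem_biUnion {c : ℤ} (hc : c ≠ 0)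
    (hw : w ∉ c.natAbs.primeFactors.attach.biUnion fun p => placesOver L p.1) :
    w.valuation L (c : L) = 1 := by
  have h := valuation_natCast_eq_one_of_not_mem_biUnion w (Int.natAbs_ne_zero.mpr hc) hw
  rcases Int.natAbs_eq c with hc' | hc'
  · rw [hc', Int.cast_natCast]
    exact h
  · rw [hc', Int.cast_neg, Int.cast_natCast, Valuation.map_neg]
    exact h

/-- **Dominant term.** If `p ∈ ℤ[t]` has `w`-unit leading coefficient and `|x|_w > 1`, then
`|p(x)|_w = |x|_w ^ {deg p}`: every lower term `p_i x^i` (`p_i ∈ ℤ`, `|p_i|_w ≤ 1`, `i < deg p`) is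
strictly smaller than the top one (ultrametric inequality, strict form) — the computation behind
«`|x|_w > 1` ⇒ `y` meets `ρ*C` only through `∞`». [cite: MochizukiGenEll2010, Def 1.5 (iv) p.8] -/
theorem valuation_aeval_eq_pow_of_one_lt {p : ℤ[X]}
    (hlc : w.valuation L (p.leadingCoeff : L) = 1) {x : L} (hx : 1 < w.valuation L x) :
    w.valuation L (aeval x p) = w.valuation L x ^ p.natDegree := by
  classical
  have hN : p.natDegree ∈ Finset.range (p.natDegree + 1) := Finset.self_mem_range_succ _
  have htop : w.valuation L (p.coeff p.natDegree • x ^ p.natDegree) =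
      w.valuation L x ^ p.natDegree := by
    rw [Algebra.smul_def, map_mul, map_pow, eq_intCast, Polynomial.coeff_natDegree, hlc, one_mul]
  rw [aeval_eq_sum_range, (w.valuation L).map_sum_eq_of_lt hN, htop]
  intro i hi
  rw [Finset.mem_sdiff, Finset.mem_range, Finset.mem_singleton] at hi
  have hlt : i < p.natDegree := lt_of_le_of_ne (Nat.le_of_lt_succ hi.1) hi.2
  rw [htop, Algebra.smul_def, map_mul, map_pow, eq_intCast]
  calc w.valuation L (p.coeff i : L) * w.valuation L x ^ i
      ≤ 1 * w.valuation L x ^ i := mul_le_mul' (valuation_intCast_le_one w _) le_rfl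
    _ = w.valuation L x ^ i := one_mul _
    _ < w.valuation L x ^ p.natDegree := pow_lt_pow_right₀ hx hlt

end Val

/-! ### The degree of `m = f·g·(f − g)` -/

namespace P1FiniteMap

/-- If `f`, `g`, `f − g` have exact degree `n` then `m = f·g·(f−g) ≠ 0`. [cite: MochizukiGenEll2010, Prop 1.7 p.9] -/
theorem pullbackCusps_poly_ne_zero (ρ : P1FiniteMap) (hdeg : 0 < ρ.deg)
    (hnum : ρ.num.natDegree = ρ.deg) (hden : ρ.den.natDegree = ρ.deg)
    (hsub : (ρ.num - ρ.den).natDegree = ρ.deg) : ρ.pullbackCusps.poly ≠ 0 := by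
  have h0 : ∀ q : ℤ[X], q.natDegree = ρ.deg → q ≠ 0 := by
    rintro q hq rfl
    rw [natDegree_zero] at hq
    omega
  exact mul_ne_zero (mul_ne_zero (h0 _ hnum) (h0 _ hden)) (h0 _ hsub)

/-- With `f`, `g`, `f − g` of exact degree `n` and `m ≠ 0`, `deg m = 3n` (`= ρ.pullbackCusps.deg`).
[cite: MochizukiGenEll2010, Prop 1.7 p.9] -/
theorem natDegree_pullbackCusps_poly (ρ : P1FiniteMap)
    (hnum : ρ.num.natDegree = ρ.deg) (hden : ρ.den.natDegree = ρ.deg)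
    (hsub : (ρ.num - ρ.den).natDegree = ρ.deg) (hm0 : ρ.pullbackCusps.poly ≠ 0) :
    ρ.pullbackCusps.poly.natDegree = ρ.pullbackCusps.deg := by
  have h : ρ.pullbackCusps.poly = ρ.num * ρ.den * (ρ.num - ρ.den) := rfl
  rw [h] at hm0 ⊢
  have h12 : ρ.num * ρ.den ≠ 0 := left_ne_zero_of_mul hm0
  have h3 : ρ.num - ρ.den ≠ 0 := right_ne_zero_of_mul hm0
  have h1 : ρ.num ≠ 0 := left_ne_zero_of_mul h12
  have h2 : ρ.den ≠ 0 := right_ne_zero_of_mul h12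
  show (ρ.num * ρ.den * (ρ.num - ρ.den)).natDegree = 3 * ρ.deg
  rw [natDegree_mul h12 h3, natDegree_mul h1 h2, hnum, hden, hsub]
  ring

end P1FiniteMap

/-! ### Meeting `ρ*C` at a good prime forces adic proximity to a root -/

namespace NFPoint

open scoped Classical in
/-- **Piece (J-B), per point and place.** Let `ρ` have `f`, `g`, `f − g` of exact degree `n` and
`m = f·g·(f−g) ≠ 0`; let `y = (x : 1)` be a point over `L` such that `m` splits over `L`, and `w` a
finite place of `L` at which the leading coefficient of `m` is a unit. If `y` meets `ρ*C` at `w`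
(`|m(x)|_w < max(|x|_w, 1)^{3n}`, Def. 1.5 (iv)), then `|x − b|_w < 1` for some root `b ∈ L` of `m`.
(`|x|_w > 1` is impossible: then `|m(x)|_w = |x|_w^{3n}` by the dominant term; for `|x|_w ≤ 1`,
`m(x) = lc·∏_b (x − b)` over the roots with multiplicity, so some factor has `|x − b|_w < 1`.)
[cite: MochizukiGenEll2010, Def 1.5 (iv) p.8] -/
theorem exists_root_valuation_sub_lt_one_of_mem_condSupportDiv (ρ : P1FiniteMap)
    (hnum : ρ.num.natDegree = ρ.deg) (hden : ρ.den.natDegree = ρ.deg)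
    (hsub : (ρ.num - ρ.den).natDegree = ρ.deg) (hm0 : ρ.pullbackCusps.poly ≠ 0)
    (Q : NFPoint) (hsplit : (ρ.pullbackCusps.poly.map (Int.castRingHom Q.F)).Splits)
    (w : HeightOneSpectrum (𝓞 Q.F)) (hw : w ∈ Q.condSupportDiv ρ.pullbackCusps)
    (hlc : w.valuation Q.F (ρ.pullbackCusps.poly.leadingCoeff : Q.F) = 1) :
    ∃ b ∈ (ρ.pullbackCusps.poly.map (Int.castRingHom Q.F)).roots.toFinset,
      w.valuation Q.F (Q.x - b) < 1 := by
  classical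
  have hN := ρ.natDegree_pullbackCusps_poly hnum hden hsub hm0
  have hcond : w.valuation Q.F (aeval Q.x ρ.pullbackCusps.poly) <
      max (w.valuation Q.F Q.x) 1 ^ ρ.pullbackCusps.deg := hw
  rcases le_or_gt (w.valuation Q.F Q.x) 1 with hx | hx
  · -- `x` is `w`-integral: split `m(x)` over the roots
    rw [max_eq_right hx, one_pow] at hcond
    have heval : aeval Q.x ρ.pullbackCusps.poly =
        (ρ.pullbackCusps.poly.map (Int.castRingHom Q.F)).eval Q.x := by
      rw [aeval_def, eval_map, algebraMap_int_eq]
    rw [heval, hsplit.eval_eq_prod_roots,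
      leadingCoeff_map_of_injective (Int.castRingHom Q.F).injective_int, map_mul,
      eq_intCast, hlc, one_mul, map_multiset_prod, Multiset.map_map] at hcond
    by_contra hall
    refine absurd hcond (not_lt.mpr (Multiset.one_le_prod_of_one_le fun a ha => ?_))
    obtain ⟨b, hb, rfl⟩ := Multiset.mem_map.mp ha
    exact not_lt.mp fun hlt => hall ⟨b, Multiset.mem_toFinset.mpr hb, hlt⟩
  · -- `|x|_w > 1` contradicts meeting the divisor at `w`
    exfalso
    rw [valuation_aeval_eq_pow_of_one_lt w hlc hx, hN, max_eq_left hx.le] at hcond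
    exact lt_irrefl _ hcond

open scoped Classical in
/-- `ord`-form of the previous theorem for a point OFF `ρ*C` (`m(x) ≠ 0`, so `x` is not a root and
`|x − b|_w < 1 ↔ 0 < ord_w(x − b)`). [cite: MochizukiGenEll2010, Def 1.5 (iv) p.8] -/
theorem exists_root_ord_sub_pos_of_mem_condSupportDiv (ρ : P1FiniteMap)
    (hnum : ρ.num.natDegree = ρ.deg) (hden : ρ.den.natDegree = ρ.deg)
    (hsub : (ρ.num - ρ.den).natDegree = ρ.deg) (hm0 : ρ.pullbackCusps.poly ≠ 0)
    (Q : NFPoint) (hoff : Q.OffDiv ρ.pullbackCusps)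
    (hsplit : (ρ.pullbackCusps.poly.map (Int.castRingHom Q.F)).Splits)
    (w : HeightOneSpectrum (𝓞 Q.F)) (hw : w ∈ Q.condSupportDiv ρ.pullbackCusps)
    (hlc : w.valuation Q.F (ρ.pullbackCusps.poly.leadingCoeff : Q.F) = 1) :
    ∃ b ∈ (ρ.pullbackCusps.poly.map (Int.castRingHom Q.F)).roots.toFinset,
      0 < ord Q.F w (Q.x - b) := by
  classical
  obtain ⟨b, hb, hlt⟩ :=
    Q.exists_root_valuation_sub_lt_one_of_mem_condSupportDiv ρ hnum hden hsub hm0 hsplit w hw hlc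
  refine ⟨b, hb, (ord_pos_iff_valuation_lt_one Q.F w ?_).mpr hlt⟩
  intro hxb
  have hxb' : Q.x = b := sub_eq_zero.mp hxb
  have hM0 : ρ.pullbackCusps.poly.map (Int.castRingHom Q.F) ≠ 0 := fun h =>
    hm0 ((Polynomial.map_eq_zero_iff (Int.castRingHom Q.F).injective_int).mp h)
  have hroot : (ρ.pullbackCusps.poly.map (Int.castRingHom Q.F)).eval b = 0 :=
    (mem_roots hM0).mp (Multiset.mem_toFinset.mp hb)
  apply hoff
  show aeval Q.x ρ.pullbackCusps.poly = 0
  rw [aeval_def, ← eval_map, algebraMap_int_eq, hxb', hroot]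

end NFPoint

/-! ### Packaged forms: one finite set of rational primes for all points and fields -/

namespace P1FiniteMap

open scoped Classical in
/-- **Piece (J-B), packaged (valuation form).** For `ρ` with `f`, `g`, `f − g` of exact degree `n` and
`m = f·g·(f−g) ≠ 0` there is ONE finite set `S` of rational primes (the prime factors of the leading
coefficient of `m`) such that for every point `y = (x : 1)` over a number field `L` over which `m`
splits, and every finite place `w` of `L` NOT over `S` at which `y` meets `ρ*C`: `|x − b|_w < 1` for
some root `b ∈ L` of `m`. [cite: MochizukiGenEll2010, Def 1.5 (iv) p.8] -/
theorem exists_primes_root_valuation_sub_lt_one (ρ : P1FiniteMap)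
    (hnum : ρ.num.natDegree = ρ.deg) (hden : ρ.den.natDegree = ρ.deg)
    (hsub : (ρ.num - ρ.den).natDegree = ρ.deg) (hm0 : ρ.pullbackCusps.poly ≠ 0) :
    ∃ S : Finset ℕ, (∀ p ∈ S, p.Prime) ∧ ∀ (Q : NFPoint),
      (ρ.pullbackCusps.poly.map (Int.castRingHom Q.F)).Splits →
      ∀ w ∈ Q.condSupportDiv ρ.pullbackCusps,
        w ∉ S.attach.biUnion (fun p => placesOver Q.F p.1) →
        ∃ b ∈ (ρ.pullbackCusps.poly.map (Int.castRingHom Q.F)).roots.toFinset,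
          w.valuation Q.F (Q.x - b) < 1 := by
  have hlc0 : ρ.pullbackCusps.poly.leadingCoeff ≠ 0 := leadingCoeff_ne_zero.mpr hm0
  refine ⟨ρ.pullbackCusps.poly.leadingCoeff.natAbs.primeFactors,
    fun p hp => Nat.prime_of_mem_primeFactors hp, fun Q hsplit w hw hS => ?_⟩
  exact Q.exists_root_valuation_sub_lt_one_of_mem_condSupportDiv ρ hnum hden hsub hm0 hsplit w hw
    (valuation_intCast_eq_one_of_not_mem_biUnion w hlc0 hS)

open scoped Classical in
/-- **Piece (J-B), packaged (`ord` form, the shape consumed by the `GenEllTwo` mechanism assembly)**: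
«`z = ρ(t)` meets a cusp ⇒ `t` meets `B := roots(m)`, off the bad primes of `ρ`» — with `S` the prime
factors of the leading coefficient of `m = f·g·(f−g)`, for every point `y = (x : 1)` OFF `ρ*C` over a
number field `L` over which `m` splits, and every finite place `w ∤ S` of `L` at which `y` meets
`ρ*C`: `0 < ord_w(x − b)` for some root `b ∈ L` of `m`. [cite: MochizukiGenEll2010, Def 1.5 (iv) p.8] -/
theorem exists_primes_root_ord_sub_pos (ρ : P1FiniteMap)
    (hnum : ρ.num.natDegree = ρ.deg) (hden : ρ.den.natDegree = ρ.deg)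
    (hsub : (ρ.num - ρ.den).natDegree = ρ.deg) (hm0 : ρ.pullbackCusps.poly ≠ 0) :
    ∃ S : Finset ℕ, (∀ p ∈ S, p.Prime) ∧ ∀ (Q : NFPoint), Q.OffDiv ρ.pullbackCusps →
      (ρ.pullbackCusps.poly.map (Int.castRingHom Q.F)).Splits →
      ∀ w ∈ Q.condSupportDiv ρ.pullbackCusps,
        w ∉ S.attach.biUnion (fun p => placesOver Q.F p.1) →
        ∃ b ∈ (ρ.pullbackCusps.poly.map (Int.castRingHom Q.F)).roots.toFinset,
          0 < ord Q.F w (Q.x - b) := by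
  have hlc0 : ρ.pullbackCusps.poly.leadingCoeff ≠ 0 := leadingCoeff_ne_zero.mpr hm0
  refine ⟨ρ.pullbackCusps.poly.leadingCoeff.natAbs.primeFactors,
    fun p hp => Nat.prime_of_mem_primeFactors hp, fun Q hoff hsplit w hw hS => ?_⟩
  exact Q.exists_root_ord_sub_pos_of_mem_condSupportDiv ρ hnum hden hsub hm0 hoff hsplit w hw
    (valuation_intCast_eq_one_of_not_mem_biUnion w hlc0 hS)

open scoped Classical in
/-- The `ord` form under the degree hypotheses alone (`n > 0` and `f`, `g`, `f − g` of exact degree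
`n`, which force `m ≠ 0`). [cite: MochizukiGenEll2010, Def 1.5 (iv) p.8] -/
theorem exists_primes_root_ord_sub_pos_of_pos (ρ : P1FiniteMap) (hdeg : 0 < ρ.deg)
    (hnum : ρ.num.natDegree = ρ.deg) (hden : ρ.den.natDegree = ρ.deg)
    (hsub : (ρ.num - ρ.den).natDegree = ρ.deg) :
    ∃ S : Finset ℕ, (∀ p ∈ S, p.Prime) ∧ ∀ (Q : NFPoint), Q.OffDiv ρ.pullbackCusps →
      (ρ.pullbackCusps.poly.map (Int.castRingHom Q.F)).Splits →
      ∀ w ∈ Q.condSupportDiv ρ.pullbackCusps,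
        w ∉ S.attach.biUnion (fun p => placesOver Q.F p.1) →
        ∃ b ∈ (ρ.pullbackCusps.poly.map (Int.castRingHom Q.F)).roots.toFinset,
          0 < ord Q.F w (Q.x - b) :=
  ρ.exists_primes_root_ord_sub_pos hnum hden hsub (ρ.pullbackCusps_poly_ne_zero hdeg hnum hden hsub)

end P1FiniteMap

end Literature.NumberTheory.DiophantineGeometry.GenEll

end
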